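import Summits.QuantumFields.YangMills.Theorems.BalabanUVNodesN21ShellSplitOfRecord13CoPH

/-!
# N21 (NE7c) · THE SHELL SPLIT OF RECORD, KEYED: `T4IndicatorShell.ShellWeightBound` at the reading's carriers `(classSet₁₃, weightA₁₃, weightB₁₃, shellA₁₃, shellB₁₃)`
# and AT `crOfRecord₁₃At K₀ jcut (shellSplitOfRecord₁₃At N K₀ ρA ρB)` from the per-top-cube (M1); on the LIVE-SELECTOR line with n20-d's extraction rows only

R134 seat `pub-ymgap-dag-n21-d` (g9), node N21 = NE7c (NOT PRINTED, NOT proved), strategy s2; lane K3⁷ `SpineGivenEndpointR13SepCoPH` (stmt-QuantumFields-20544,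
`--supports … --as helper`; COUNT-NEUTRAL).  Imports the term-level file `…N21ShellSplitOfRecord13CoPH` (§1–§4: (R)-fields, cover, (M1) ⇒ totals, core, count).

WHAT THIS FILE PROVES (theorems only; 0 `def`, 0 `sorry`).
* §5 AT THE `CoPH`-KEYED STAGE-13 RECORD: the class-set sums of the keyed shell parts ∕ weights are the runs' TERM sums (`sum_classSet₁₃_shellA₁₃ ∕ _weightA₁₃ ∕ _shellB₁₃ ∕
  _weightB₁₃`, keys land in the class set); `shellA₁₃_nonneg ∕ shellB₁₃_nonneg ∕ shellA₁₃_le_weightA₁₃ ∕ shellB₁₃_le_weightB₁₃`; ★★ `shellWeightBound_classSet₁₃_of_cubeAC` —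
  `ShellWeightBound 1 (classSet₁₃ θ K₀ g₀) (weightA₁₃ …) (weightB₁₃ …) (shellA₁₃ … ρA) (shellB₁₃ … ρB) (K ↦ (2L^m)⁴·(D^A_K ρ^A_K + D^B_K ρ^B_K))` from the two runs'
  per-top-cube (M1) + `Summable (D ρ)` + signs + the displayed rows ((H-U), `0 ≤ ζ`, F3's (e1) integrability); ★★★ `shellWeightBound_crOfRecord₁₃At_shellSplit` — N21's face
  AT `crOfRecord₁₃At K₀ jcut (shellSplitOfRecord₁₃At N K₀ ρA ρB)` incl. its CANONICAL `Wsh` (n20-d `shellWeightBound_crOfRecord₁₃At` BY NAME).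
* §6 ON THE LIVE-SELECTOR LINE (where the K3 skeleton's stub 2 pins `cr := crOfRecord₁₃`): F3's (e1) integrability row is a THEOREM
  (`integrable_chi_mul_dressedSlots_of_ppSelLive`: dag-n19-c's tower identity `dressedSlotsOfDatum₉_ppSelLive_eq_ppSelId` + dag-n19-d's
  `integrable_chi_mul_dressedSlotsOfDatum₉_of_ppSelId`, BY NAME) ⇒ ★★★ `shellWeightBound_crOfRecord₁₃At_shellSplit_of_liveSel`: displayed rows = n20-d's extraction rows
  (`hsel`, (H-U), (H-ζ), `0 ≤ ζ`) + signs + `Summable (D ρ)` + the per-top-cube (M1).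

THE ONE DISPLAYED ESTIMATE, per run, per `(K, t, top cube a)` — (M1) ON THE RECORD's `a`-TRUNCATED DRESSED LAW with constant `D_K ρ_K`, `Σ_K D_K ρ_K < ∞`:
  `Σ_s shellPieceOfDatum₉ … (ρ K) t a s ≤ (D_K ρ_K) · Σ_s cubeWeightOfDatum₉ … t a s`   — NOT PRINTED; NOT proved here.

HONEST FRAMING.  [folklore] bookkeeping BY NAME over NODE 00's objects of record and the term-level file; NO estimate of Bałaban's asserted or used; `ρA ∕ ρB` are
LETTERS (A6: the zero width is the junk instance — content only at N16's closeness widths jointly with N19′'s core); `jcut` not read; no `Provisos₁₃CoPH` inhabitant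
claimed (K0⁷ open); NE7c NOT proved; N21 NOT discharged; K3⁷ NOT claimed; counts UNMOVED (typed 28∕28 · discharged 5∕27); never a count claim.  No `instance`, no
`notation`, no `def`.  One finite four-torus programme at fixed `ε` — NOT ℝ⁴, NOT OS, NOT a mass gap, NOT the Clay problem.
-/

noncomputable section

open scoped BigOperators
open Finset MeasureTheory

namespace Summit.QuantumFields.YangMills.Theorems.N21ShellSplitOfRecord13CoPH

open Literature.MathematicalPhysics.QuantumFieldTheory.Balaban1983to89
open Literature.MathematicalPhysics.QuantumFieldTheory.Balaban1983to89.T4Continuum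
open Literature.MathematicalPhysics.QuantumFieldTheory.Balaban1983to89.Node00
open T4IndicatorShell (ShellWeightBound)
open YMDAG.UVSplit (crOfRecord₁₃At ShellSplit₁₃CoPH keyA₁₃ keyB₁₃ runA₁₃ runB₁₃ histA₁₃ histB₁₃ classSet₁₃ weightA₁₃ weightB₁₃
  shellWeightBound_crOfRecord₁₃At histA₁₃_zero histB₁₃_zero)
open Summit.QuantumFields.YangMills.BalabanUVNodes.N19MGFRoadLiveSelectorTower (dressedSlotsOfDatum₉_ppSelLive_eq_ppSelId)
open Summit.QuantumFields.YangMills.BalabanUVNodes.N19MGFFormAtRecord (wOfRecord₉_nonneg wOfRecord₉_le_one integrable_chi_mul_dressedSlotsOfDatum₉_of_ppSelId)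


/-! ## §5 At the `CoPH`-keyed Stage-13 record: `ShellWeightBound` at the reading's carriers and AT `crOfRecord₁₃At` -/

section AtRecord

variable {F : T4Family} {N : ℕ} [NeZero N]

/-- run A: over the class set of record, the keyed shell parts sum to the TERM-LEVEL total (keys land in the class set; `Finset.sum_fiberwise_of_maps_to`). [bookkeeping] -/
theorem sum_classSet₁₃_shellA₁₃ (K₀ : ℕ) (θ : Stage13HParams F N) (hP : θ.Provisos₁₃CoPH F N) (g₀ : ℕ → ℝ) (os : List (ULoop F)) (ρ : ℕ → ℝ)
    (K : ℕ) (t : ℝ) :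
    ∑ x ∈ classSet₁₃ θ K₀ g₀ K, shellA₁₃ θ hP K₀ g₀ os ρ K t x =
      ∑ s, shellWeightOfDatum₉ F N θ.toStage9Params (datumOfRecord₁₃CoPH F N θ hP) g₀ os (runA₁₃ F K₀ g₀ K) (histA₁₃ θ K₀ g₀ K) (K₀ + K) (ρ K) t s := by
  letI : ∀ Kc, DecidableEq (SiteSeqKey F Kc) := fun _ => Classical.decEq _
  exact Finset.sum_fiberwise_of_maps_to (s := Finset.univ) (t := classSet₁₃ θ K₀ g₀ K) (g := keyA₁₃ θ K₀ g₀ K)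
    (fun s _ => Finset.mem_union_left _ (Finset.mem_image_of_mem _ (Finset.mem_univ s))) _

/-- run A: over the class set of record, the keyed class weights sum to the run's full term sum. [bookkeeping] -/
theorem sum_classSet₁₃_weightA₁₃ (K₀ : ℕ) (θ : Stage13HParams F N) (hP : θ.Provisos₁₃CoPH F N) (g₀ : ℕ → ℝ) (os : List (ULoop F)) (K : ℕ) (t : ℝ) :
    ∑ x ∈ classSet₁₃ θ K₀ g₀ K, weightA₁₃ θ hP K₀ g₀ os K t x =
      ∑ s, classWeightOfDatum₉ F N θ.toStage9Params (datumOfRecord₁₃CoPH F N θ hP) g₀ os (runA₁₃ F K₀ g₀ K) (histA₁₃ θ K₀ g₀ K) (K₀ + K) t s := by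
  letI : ∀ Kc, DecidableEq (SiteSeqKey F Kc) := fun _ => Classical.decEq _
  exact Finset.sum_fiberwise_of_maps_to (s := Finset.univ) (t := classSet₁₃ θ K₀ g₀ K) (g := keyA₁₃ θ K₀ g₀ K)
    (fun s _ => Finset.mem_union_left _ (Finset.mem_image_of_mem _ (Finset.mem_univ s))) _

/-- run B: over the class set of record, the keyed shell parts sum to the TERM-LEVEL total. [bookkeeping] -/
theorem sum_classSet₁₃_shellB₁₃ (K₀ : ℕ) (θ : Stage13HParams F N) (hP : θ.Provisos₁₃CoPH F N) (g₀ : ℕ → ℝ) (os : List (ULoop F)) (ρ : ℕ → ℝ)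
    (K : ℕ) (t : ℝ) :
    ∑ x ∈ classSet₁₃ θ K₀ g₀ K, shellB₁₃ θ hP K₀ g₀ os ρ K t x =
      ∑ s', shellWeightOfDatum₉ F N θ.toStage9Params (datumOfRecord₁₃CoPH F N θ hP) g₀ os (runB₁₃ F K₀ g₀ K) (histB₁₃ θ K₀ g₀ K) (K₀ + K + 1) (ρ K) t s' := by
  letI : ∀ Kc, DecidableEq (SiteSeqKey F Kc) := fun _ => Classical.decEq _
  exact Finset.sum_fiberwise_of_maps_to (s := Finset.univ) (t := classSet₁₃ θ K₀ g₀ K) (g := keyB₁₃ θ K₀ g₀ K)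
    (fun s' _ => Finset.mem_union_right _ (Finset.mem_image_of_mem _ (Finset.mem_univ s'))) _

/-- run B: over the class set of record, the keyed class weights sum to the run's full term sum. [bookkeeping] -/
theorem sum_classSet₁₃_weightB₁₃ (K₀ : ℕ) (θ : Stage13HParams F N) (hP : θ.Provisos₁₃CoPH F N) (g₀ : ℕ → ℝ) (os : List (ULoop F)) (K : ℕ) (t : ℝ) :
    ∑ x ∈ classSet₁₃ θ K₀ g₀ K, weightB₁₃ θ hP K₀ g₀ os K t x =
      ∑ s', classWeightOfDatum₉ F N θ.toStage9Params (datumOfRecord₁₃CoPH F N θ hP) g₀ os (runB₁₃ F K₀ g₀ K) (histB₁₃ θ K₀ g₀ K) (K₀ + K + 1) t s' := by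
  letI : ∀ Kc, DecidableEq (SiteSeqKey F Kc) := fun _ => Classical.decEq _
  exact Finset.sum_fiberwise_of_maps_to (s := Finset.univ) (t := classSet₁₃ θ K₀ g₀ K) (g := keyB₁₃ θ K₀ g₀ K)
    (fun s' _ => Finset.mem_union_right _ (Finset.mem_image_of_mem _ (Finset.mem_univ s'))) _

/-- run A: the keyed shell part of record is nonnegative (`0 ≤ ζ`). [bookkeeping] -/
theorem shellA₁₃_nonneg (K₀ : ℕ) (θ : Stage13HParams F N) (hP : θ.Provisos₁₃CoPH F N) (g₀ : ℕ → ℝ) (os : List (ULoop F))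
    (hζ0 : ∀ p g k s Pl Ql RS U V', 0 ≤ θ.ζ p g k s Pl Ql RS U V') (ρ : ℕ → ℝ) (K : ℕ) (t : ℝ) (x : Σ K, SiteSeqKey F (K₀ + K)) :
    0 ≤ shellA₁₃ θ hP K₀ g₀ os ρ K t x :=
  Finset.sum_nonneg fun s _ => shellWeightOfDatum₉_nonneg F N θ.toStage9Params (datumOfRecord₁₃CoPH F N θ hP) g₀ os (runA₁₃ F K₀ g₀ K)
    (histA₁₃ θ K₀ g₀ K) (K₀ + K) (wOfRecord₉_nonneg θ.toStage9Params hζ0 _ _) (ρ K) t s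

/-- run B: the keyed shell part of record is nonnegative. [bookkeeping] -/
theorem shellB₁₃_nonneg (K₀ : ℕ) (θ : Stage13HParams F N) (hP : θ.Provisos₁₃CoPH F N) (g₀ : ℕ → ℝ) (os : List (ULoop F))
    (hζ0 : ∀ p g k s Pl Ql RS U V', 0 ≤ θ.ζ p g k s Pl Ql RS U V') (ρ : ℕ → ℝ) (K : ℕ) (t : ℝ) (x : Σ K, SiteSeqKey F (K₀ + K)) :
    0 ≤ shellB₁₃ θ hP K₀ g₀ os ρ K t x :=
  Finset.sum_nonneg fun s' _ => shellWeightOfDatum₉_nonneg F N θ.toStage9Params (datumOfRecord₁₃CoPH F N θ hP) g₀ os (runB₁₃ F K₀ g₀ K)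
    (histB₁₃ θ K₀ g₀ K) (K₀ + K + 1) (wOfRecord₉_nonneg θ.toStage9Params hζ0 _ _) (ρ K) t s'

/-- run A: the keyed shell part never exceeds the keyed class weight (fibre sums are monotone; F3's (e1) integrability displayed). [bookkeeping] -/
theorem shellA₁₃_le_weightA₁₃ (K₀ : ℕ) (θ : Stage13HParams F N) (hP : θ.Provisos₁₃CoPH F N) (g₀ : ℕ → ℝ) (os : List (ULoop F))
    (hζ0 : ∀ p g k s Pl Ql RS U V', 0 ≤ θ.ζ p g k s Pl Ql RS U V')
    (hintA : ∀ (K : ℕ) (t : ℝ) (s : SeqOfRecord F θ.ν θ.τ9.M (histA₁₃ θ K₀ g₀ K) (K₀ + K) (K₀ + K)),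
      Integrable (fun V => chiSeqOfRecord F N θ.ν θ.τ9.M (histA₁₃ θ K₀ g₀ K) (K₀ + K) (K₀ + K) s V *
        dressedSlotsOfDatum₉ F N θ.toStage9Params (datumOfRecord₁₃CoPH F N θ hP) g₀ os t (runA₁₃ F K₀ g₀ K) (histA₁₃ θ K₀ g₀ K) (K₀ + K) s V)
        (fieldMeasure (F.P (K₀ + K)) (K₀ + K) (SU N)))
    (ρ : ℕ → ℝ) (K : ℕ) (t : ℝ) (x : Σ K, SiteSeqKey F (K₀ + K)) :
    shellA₁₃ θ hP K₀ g₀ os ρ K t x ≤ weightA₁₃ θ hP K₀ g₀ os K t x :=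
  Finset.sum_le_sum fun s _ => shellWeightOfDatum₉_le_classWeight F N θ.toStage9Params (datumOfRecord₁₃CoPH F N θ hP) g₀ os (runA₁₃ F K₀ g₀ K)
    (histA₁₃ θ K₀ g₀ K) (K₀ + K) (wOfRecord₉_nonneg θ.toStage9Params hζ0 _ _) (ρ K) t s (hintA K t s)

/-- run B: the keyed shell part never exceeds the keyed class weight. [bookkeeping] -/
theorem shellB₁₃_le_weightB₁₃ (K₀ : ℕ) (θ : Stage13HParams F N) (hP : θ.Provisos₁₃CoPH F N) (g₀ : ℕ → ℝ) (os : List (ULoop F))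
    (hζ0 : ∀ p g k s Pl Ql RS U V', 0 ≤ θ.ζ p g k s Pl Ql RS U V')
    (hintB : ∀ (K : ℕ) (t : ℝ) (s' : SeqOfRecord F θ.ν θ.τ9.M (histB₁₃ θ K₀ g₀ K) (K₀ + K + 1) (K₀ + K + 1)),
      Integrable (fun V => chiSeqOfRecord F N θ.ν θ.τ9.M (histB₁₃ θ K₀ g₀ K) (K₀ + K + 1) (K₀ + K + 1) s' V *
        dressedSlotsOfDatum₉ F N θ.toStage9Params (datumOfRecord₁₃CoPH F N θ hP) g₀ os t (runB₁₃ F K₀ g₀ K) (histB₁₃ θ K₀ g₀ K) (K₀ + K + 1) s' V)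
        (fieldMeasure (F.P (K₀ + K + 1)) (K₀ + K + 1) (SU N)))
    (ρ : ℕ → ℝ) (K : ℕ) (t : ℝ) (x : Σ K, SiteSeqKey F (K₀ + K)) :
    shellB₁₃ θ hP K₀ g₀ os ρ K t x ≤ weightB₁₃ θ hP K₀ g₀ os K t x :=
  Finset.sum_le_sum fun s' _ => shellWeightOfDatum₉_le_classWeight F N θ.toStage9Params (datumOfRecord₁₃CoPH F N θ hP) g₀ os (runB₁₃ F K₀ g₀ K)
    (histB₁₃ θ K₀ g₀ K) (K₀ + K + 1) (wOfRecord₉_nonneg θ.toStage9Params hζ0 _ _) (ρ K) t s' (hintB K t s')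

/-- ★★ **N21 (NE7c) AT THE KEYED CARRIERS OF RECORD FROM THE PER-TOP-CUBE (M1).**  At a `CoPH`-keyed Stage-13 tuple `(F, θ, hP, g₀, os)` and offset `K₀`, with the
shell split OF RECORD (`shellA₁₃ ∕ shellB₁₃` at width letters `ρA ∕ ρB`): DISPLAYED — (H-U) `LocalBgMeasurable θ.ν`, `0 ≤ ζ`, F3's (e1) integrability of the two runs'
top-level pieces, signs `0 ≤ ρ, 0 ≤ D`, `Summable (D^A ρ^A)`, `Summable (D^B ρ^B)`, and THE estimate: per run, per `(K, t, top cube a)`, (M1) on the record's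
`a`-truncated dressed law with constant `D_K ρ_K`.  THEN `ShellWeightBound 1 (classSet₁₃ θ K₀ g₀) (weightA₁₃ …) (weightB₁₃ …) (shellA₁₃ … ρA) (shellB₁₃ … ρB)
(K ↦ (2L^m)⁴·(D^A_K ρ^A_K + D^B_K ρ^B_K))` — every (R)-field, the cover and the count PROVED here. [bookkeeping] -/
theorem shellWeightBound_classSet₁₃_of_cubeAC (K₀ : ℕ) (θ : Stage13HParams F N) (hP : θ.Provisos₁₃CoPH F N) (g₀ : ℕ → ℝ) (os : List (ULoop F))
    (hU : LocalBgMeasurable F N θ.ν) (hζ0 : ∀ p g k s Pl Ql RS U V', 0 ≤ θ.ζ p g k s Pl Ql RS U V')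
    (hintA : ∀ (K : ℕ) (t : ℝ) (s : SeqOfRecord F θ.ν θ.τ9.M (histA₁₃ θ K₀ g₀ K) (K₀ + K) (K₀ + K)),
      Integrable (fun V => chiSeqOfRecord F N θ.ν θ.τ9.M (histA₁₃ θ K₀ g₀ K) (K₀ + K) (K₀ + K) s V *
        dressedSlotsOfDatum₉ F N θ.toStage9Params (datumOfRecord₁₃CoPH F N θ hP) g₀ os t (runA₁₃ F K₀ g₀ K) (histA₁₃ θ K₀ g₀ K) (K₀ + K) s V)
        (fieldMeasure (F.P (K₀ + K)) (K₀ + K) (SU N)))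
    (hintB : ∀ (K : ℕ) (t : ℝ) (s' : SeqOfRecord F θ.ν θ.τ9.M (histB₁₃ θ K₀ g₀ K) (K₀ + K + 1) (K₀ + K + 1)),
      Integrable (fun V => chiSeqOfRecord F N θ.ν θ.τ9.M (histB₁₃ θ K₀ g₀ K) (K₀ + K + 1) (K₀ + K + 1) s' V *
        dressedSlotsOfDatum₉ F N θ.toStage9Params (datumOfRecord₁₃CoPH F N θ hP) g₀ os t (runB₁₃ F K₀ g₀ K) (histB₁₃ θ K₀ g₀ K) (K₀ + K + 1) s' V)
        (fieldMeasure (F.P (K₀ + K + 1)) (K₀ + K + 1) (SU N)))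
    {ρA ρB DA DB : ℕ → ℝ} (hρA : ∀ K, 0 ≤ ρA K) (hDA : ∀ K, 0 ≤ DA K) (hρB : ∀ K, 0 ≤ ρB K) (hDB : ∀ K, 0 ≤ DB K)
    (hsA : Summable (fun K => DA K * ρA K)) (hsB : Summable (fun K => DB K * ρB K))
    (hM1A : ∀ (K : ℕ) (t : ℝ), |t| ≤ 1 →
      ∀ a : ↥(cubeIndices (F.P (K₀ + K)) (cubeSide (F.P (K₀ + K)).L θ.ν.M₂ (RkOfRecord (F.P (K₀ + K)).L θ.ν.r (histA₁₃ θ K₀ g₀ K (K₀ + K))) (K₀ + K))),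
        ∑ s, shellPieceOfDatum₉ F N θ.toStage9Params (datumOfRecord₁₃CoPH F N θ hP) g₀ os (runA₁₃ F K₀ g₀ K) (histA₁₃ θ K₀ g₀ K) (K₀ + K) (ρA K) t a s ≤
          (DA K * ρA K) * ∑ s, cubeWeightOfDatum₉ F N θ.toStage9Params (datumOfRecord₁₃CoPH F N θ hP) g₀ os (runA₁₃ F K₀ g₀ K) (histA₁₃ θ K₀ g₀ K) (K₀ + K) t a s)
    (hM1B : ∀ (K : ℕ) (t : ℝ), |t| ≤ 1 →
      ∀ a : ↥(cubeIndices (F.P (K₀ + K + 1)) (cubeSide (F.P (K₀ + K + 1)).L θ.ν.M₂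
          (RkOfRecord (F.P (K₀ + K + 1)).L θ.ν.r (histB₁₃ θ K₀ g₀ K (K₀ + K + 1))) (K₀ + K + 1))),
        ∑ s', shellPieceOfDatum₉ F N θ.toStage9Params (datumOfRecord₁₃CoPH F N θ hP) g₀ os (runB₁₃ F K₀ g₀ K) (histB₁₃ θ K₀ g₀ K) (K₀ + K + 1) (ρB K) t a s' ≤
          (DB K * ρB K) * ∑ s', cubeWeightOfDatum₉ F N θ.toStage9Params (datumOfRecord₁₃CoPH F N θ hP) g₀ os (runB₁₃ F K₀ g₀ K) (histB₁₃ θ K₀ g₀ K) (K₀ + K + 1) t a s') :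
    ShellWeightBound 1 (classSet₁₃ θ K₀ g₀) (weightA₁₃ θ hP K₀ g₀ os) (weightB₁₃ θ hP K₀ g₀ os) (shellA₁₃ θ hP K₀ g₀ os ρA) (shellB₁₃ θ hP K₀ g₀ os ρB)
      (fun K => (2 * (F.L : ℝ) ^ F.m) ^ 4 * (DA K * ρA K + DB K * ρB K)) := by
  -- the step weights of the tuple's Stage-9 part are nonnegative
  have hw0 : ∀ (p : B12.RunParams) (g : ℕ → ℝ) k s' U V', 0 ≤ wOfRecord₉ F N θ.toStage9Params p g k s' U V' :=
    fun p g => wOfRecord₉_nonneg θ.toStage9Params hζ0 p g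
  have hνbar : 0 ≤ (2 * (F.L : ℝ) ^ F.m) ^ 4 := by positivity
  -- the two runs' term-level totals with the COUNT folded in
  have htotA : ∀ (K : ℕ) (t : ℝ), |t| ≤ 1 →
      ∑ s, shellWeightOfDatum₉ F N θ.toStage9Params (datumOfRecord₁₃CoPH F N θ hP) g₀ os (runA₁₃ F K₀ g₀ K) (histA₁₃ θ K₀ g₀ K) (K₀ + K) (ρA K) t s ≤
        ((2 * (F.L : ℝ) ^ F.m) ^ 4 * (DA K * ρA K)) *
          ∑ s, classWeightOfDatum₉ F N θ.toStage9Params (datumOfRecord₁₃CoPH F N θ hP) g₀ os (runA₁₃ F K₀ g₀ K) (histA₁₃ θ K₀ g₀ K) (K₀ + K) t s := by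
    intro K t ht
    refine (sum_shellWeight_le_of_cubeAC F N θ.toStage9Params (datumOfRecord₁₃CoPH F N θ hP) g₀ os (runA₁₃ F K₀ g₀ K) (histA₁₃ θ K₀ g₀ K) (K₀ + K)
      hU (hw0 _ _) (ρA K) t (hintA K t) (mul_nonneg (hDA K) (hρA K)) (hM1A K t ht)).trans ?_
    refine mul_le_mul_of_nonneg_right (mul_le_mul_of_nonneg_right (card_cubeIndices_top_le F (K₀ + K) _ _) (mul_nonneg (hDA K) (hρA K))) ?_
    exact Finset.sum_nonneg fun s _ => classWeightOfDatum₉_nonneg' F N θ.toStage9Params (datumOfRecord₁₃CoPH F N θ hP) g₀ os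
      (runA₁₃ F K₀ g₀ K) (histA₁₃ θ K₀ g₀ K) (K₀ + K) (hw0 _ _) t s
  have htotB : ∀ (K : ℕ) (t : ℝ), |t| ≤ 1 →
      ∑ s', shellWeightOfDatum₉ F N θ.toStage9Params (datumOfRecord₁₃CoPH F N θ hP) g₀ os (runB₁₃ F K₀ g₀ K) (histB₁₃ θ K₀ g₀ K) (K₀ + K + 1) (ρB K) t s' ≤
        ((2 * (F.L : ℝ) ^ F.m) ^ 4 * (DB K * ρB K)) *
          ∑ s', classWeightOfDatum₉ F N θ.toStage9Params (datumOfRecord₁₃CoPH F N θ hP) g₀ os (runB₁₃ F K₀ g₀ K) (histB₁₃ θ K₀ g₀ K) (K₀ + K + 1) t s' := by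
    intro K t ht
    refine (sum_shellWeight_le_of_cubeAC F N θ.toStage9Params (datumOfRecord₁₃CoPH F N θ hP) g₀ os (runB₁₃ F K₀ g₀ K) (histB₁₃ θ K₀ g₀ K) (K₀ + K + 1)
      hU (hw0 _ _) (ρB K) t (hintB K t) (mul_nonneg (hDB K) (hρB K)) (hM1B K t ht)).trans ?_
    refine mul_le_mul_of_nonneg_right (mul_le_mul_of_nonneg_right (card_cubeIndices_top_le F (K₀ + K + 1) _ _) (mul_nonneg (hDB K) (hρB K))) ?_
    exact Finset.sum_nonneg fun s' _ => classWeightOfDatum₉_nonneg' F N θ.toStage9Params (datumOfRecord₁₃CoPH F N θ hP) g₀ os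
      (runB₁₃ F K₀ g₀ K) (histB₁₃ θ K₀ g₀ K) (K₀ + K + 1) (hw0 _ _) t s'
  refine
    { nonneg := fun K => mul_nonneg hνbar (add_nonneg (mul_nonneg (hDA K) (hρA K)) (mul_nonneg (hDB K) (hρB K)))
      summable := (hsA.add hsB).mul_left _
      sh_nonneg_left := fun K t _ x _ => shellA₁₃_nonneg K₀ θ hP g₀ os hζ0 ρA K t x
      sh_le_left := fun K t _ x _ => shellA₁₃_le_weightA₁₃ K₀ θ hP g₀ os hζ0 hintA ρA K t x
      sh_nonneg_right := fun K t _ x _ => shellB₁₃_nonneg K₀ θ hP g₀ os hζ0 ρB K t x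
      sh_le_right := fun K t _ x _ => shellB₁₃_le_weightB₁₃ K₀ θ hP g₀ os hζ0 hintB ρB K t x
      left := fun K t ht => ?_
      right := fun K t ht => ?_ }
  · -- run A: both sides are full term sums, then the term-level total, then monotonicity in the constant
    rw [sum_classSet₁₃_shellA₁₃, sum_classSet₁₃_weightA₁₃]
    refine (htotA K t ht).trans (mul_le_mul_of_nonneg_right ?_ ?_)
    · exact mul_le_mul_of_nonneg_left (le_add_of_nonneg_right (mul_nonneg (hDB K) (hρB K))) hνbar
    · exact Finset.sum_nonneg fun s _ => classWeightOfDatum₉_nonneg' F N θ.toStage9Params (datumOfRecord₁₃CoPH F N θ hP) g₀ os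
        (runA₁₃ F K₀ g₀ K) (histA₁₃ θ K₀ g₀ K) (K₀ + K) (hw0 _ _) t s
  · rw [sum_classSet₁₃_shellB₁₃, sum_classSet₁₃_weightB₁₃]
    refine (htotB K t ht).trans (mul_le_mul_of_nonneg_right ?_ ?_)
    · exact mul_le_mul_of_nonneg_left (le_add_of_nonneg_left (mul_nonneg (hDA K) (hρA K))) hνbar
    · exact Finset.sum_nonneg fun s' _ => classWeightOfDatum₉_nonneg' F N θ.toStage9Params (datumOfRecord₁₃CoPH F N θ hP) g₀ os
        (runB₁₃ F K₀ g₀ K) (histB₁₃ θ K₀ g₀ K) (K₀ + K + 1) (hw0 _ _) t s'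

/-- ★★★ **N21's FACE AT THE SPINE READING OF RECORD WITH ITS SHELL SPLIT INHABITED**: under the hypotheses of `shellWeightBound_classSet₁₃_of_cubeAC` (width letters
`ρA ρB : WidthLetter₁₃CoPH N` read at the tuple), `ShellWeightBound` holds AT `crOfRecord₁₃At K₀ jcut (shellSplitOfRecord₁₃At N K₀ ρA ρB)` — its `l₀, T, A, B, shA, shB`
and its CANONICAL `Wsh` (n20-d `shellWeightBound_crOfRecord₁₃At` BY NAME).  This is leaf D's `h21` ∕ the K3 skeleton's `KeyedShellWeight` AT ONE TUPLE, for the NAMED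
split; the large-field cut `jcut` is not read. [bookkeeping] -/
theorem shellWeightBound_crOfRecord₁₃At_shellSplit (K₀ : ℕ) (jcut : ℕ → ℕ) (ρA ρB : WidthLetter₁₃CoPH N) (θ : Stage13HParams F N) (hP : θ.Provisos₁₃CoPH F N)
    (g₀ : ℕ → ℝ) (os : List (ULoop F))
    (hU : LocalBgMeasurable F N θ.ν) (hζ0 : ∀ p g k s Pl Ql RS U V', 0 ≤ θ.ζ p g k s Pl Ql RS U V')
    (hintA : ∀ (K : ℕ) (t : ℝ) (s : SeqOfRecord F θ.ν θ.τ9.M (histA₁₃ θ K₀ g₀ K) (K₀ + K) (K₀ + K)),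
      Integrable (fun V => chiSeqOfRecord F N θ.ν θ.τ9.M (histA₁₃ θ K₀ g₀ K) (K₀ + K) (K₀ + K) s V *
        dressedSlotsOfDatum₉ F N θ.toStage9Params (datumOfRecord₁₃CoPH F N θ hP) g₀ os t (runA₁₃ F K₀ g₀ K) (histA₁₃ θ K₀ g₀ K) (K₀ + K) s V)
        (fieldMeasure (F.P (K₀ + K)) (K₀ + K) (SU N)))
    (hintB : ∀ (K : ℕ) (t : ℝ) (s' : SeqOfRecord F θ.ν θ.τ9.M (histB₁₃ θ K₀ g₀ K) (K₀ + K + 1) (K₀ + K + 1)),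
      Integrable (fun V => chiSeqOfRecord F N θ.ν θ.τ9.M (histB₁₃ θ K₀ g₀ K) (K₀ + K + 1) (K₀ + K + 1) s' V *
        dressedSlotsOfDatum₉ F N θ.toStage9Params (datumOfRecord₁₃CoPH F N θ hP) g₀ os t (runB₁₃ F K₀ g₀ K) (histB₁₃ θ K₀ g₀ K) (K₀ + K + 1) s' V)
        (fieldMeasure (F.P (K₀ + K + 1)) (K₀ + K + 1) (SU N)))
    {DA DB : ℕ → ℝ} (hρA : ∀ K, 0 ≤ ρA F θ hP g₀ os K) (hDA : ∀ K, 0 ≤ DA K) (hρB : ∀ K, 0 ≤ ρB F θ hP g₀ os K) (hDB : ∀ K, 0 ≤ DB K)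
    (hsA : Summable (fun K => DA K * ρA F θ hP g₀ os K)) (hsB : Summable (fun K => DB K * ρB F θ hP g₀ os K))
    (hM1A : ∀ (K : ℕ) (t : ℝ), |t| ≤ 1 →
      ∀ a : ↥(cubeIndices (F.P (K₀ + K)) (cubeSide (F.P (K₀ + K)).L θ.ν.M₂ (RkOfRecord (F.P (K₀ + K)).L θ.ν.r (histA₁₃ θ K₀ g₀ K (K₀ + K))) (K₀ + K))),
        ∑ s, shellPieceOfDatum₉ F N θ.toStage9Params (datumOfRecord₁₃CoPH F N θ hP) g₀ os (runA₁₃ F K₀ g₀ K) (histA₁₃ θ K₀ g₀ K) (K₀ + K)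
            (ρA F θ hP g₀ os K) t a s ≤
          (DA K * ρA F θ hP g₀ os K) *
            ∑ s, cubeWeightOfDatum₉ F N θ.toStage9Params (datumOfRecord₁₃CoPH F N θ hP) g₀ os (runA₁₃ F K₀ g₀ K) (histA₁₃ θ K₀ g₀ K) (K₀ + K) t a s)
    (hM1B : ∀ (K : ℕ) (t : ℝ), |t| ≤ 1 →
      ∀ a : ↥(cubeIndices (F.P (K₀ + K + 1)) (cubeSide (F.P (K₀ + K + 1)).L θ.ν.M₂
          (RkOfRecord (F.P (K₀ + K + 1)).L θ.ν.r (histB₁₃ θ K₀ g₀ K (K₀ + K + 1))) (K₀ + K + 1))),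
        ∑ s', shellPieceOfDatum₉ F N θ.toStage9Params (datumOfRecord₁₃CoPH F N θ hP) g₀ os (runB₁₃ F K₀ g₀ K) (histB₁₃ θ K₀ g₀ K) (K₀ + K + 1)
            (ρB F θ hP g₀ os K) t a s' ≤
          (DB K * ρB F θ hP g₀ os K) *
            ∑ s', cubeWeightOfDatum₉ F N θ.toStage9Params (datumOfRecord₁₃CoPH F N θ hP) g₀ os (runB₁₃ F K₀ g₀ K) (histB₁₃ θ K₀ g₀ K) (K₀ + K + 1) t a s') :
    ShellWeightBound (crOfRecord₁₃At K₀ jcut (shellSplitOfRecord₁₃At N K₀ ρA ρB) F θ hP g₀ os).l₀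
      (crOfRecord₁₃At K₀ jcut (shellSplitOfRecord₁₃At N K₀ ρA ρB) F θ hP g₀ os).T (crOfRecord₁₃At K₀ jcut (shellSplitOfRecord₁₃At N K₀ ρA ρB) F θ hP g₀ os).A
      (crOfRecord₁₃At K₀ jcut (shellSplitOfRecord₁₃At N K₀ ρA ρB) F θ hP g₀ os).B (crOfRecord₁₃At K₀ jcut (shellSplitOfRecord₁₃At N K₀ ρA ρB) F θ hP g₀ os).shA
      (crOfRecord₁₃At K₀ jcut (shellSplitOfRecord₁₃At N K₀ ρA ρB) F θ hP g₀ os).shB (crOfRecord₁₃At K₀ jcut (shellSplitOfRecord₁₃At N K₀ ρA ρB) F θ hP g₀ os).Wsh :=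
  shellWeightBound_crOfRecord₁₃At K₀ jcut (shellSplitOfRecord₁₃At N K₀ ρA ρB) θ hP g₀ os
    (shellWeightBound_classSet₁₃_of_cubeAC K₀ θ hP g₀ os hU hζ0 hintA hintB hρA hDA hρB hDB hsA hsB hM1A hM1B)

end AtRecord

/-! ## §6 On the LIVE-SELECTOR LINE F3's (e1) integrability row is a THEOREM (dag-n19-c's tower identity + dag-n19-d's (e1)): the face with n20-d's extraction rows only -/

section LiveLine

variable {F : T4Family} {N : ℕ} [NeZero N]

/-- **F3's (e1) INTEGRABILITY AT A LIVE-SELECTOR TUPLE** (NODE 00's generality): for a Stage-9 tuple pinned at the live selector of record, under (H-U), (H-ζ), `0 ≤ ζ`,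
`|ζ| ≤ 1` and a datum with measurable averaging, every top piece `χ_k(s)·slot^t_k(s)` of a run whose history starts at the dressing's coupling is integrable —
dag-n19-c's `dressedSlotsOfDatum₉_ppSelLive_eq_ppSelId` (the live tower IS the identity re-pin's) + dag-n19-d's `integrable_chi_mul_dressedSlotsOfDatum₉_of_ppSelId`, BY NAME.
[bookkeeping] -/
theorem integrable_chi_mul_dressedSlots_of_ppSelLive (ϑ : Stage9Params F N) (E : B12.RunParams → ℝ)
    (hsel : ϑ.ppSel = ppSelLiveOfRecord F N ϑ.ν ϑ.τ9 E (wOfRecord₉ F N ϑ))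
    (hU : LocalBgMeasurable F N ϑ.ν) (hζm : ZetaMeasurable F N ϑ.ζ) (hζ0 : ∀ p g k s Pl Ql RS U V', 0 ≤ ϑ.ζ p g k s Pl Ql RS U V')
    (hζ1 : IsZetaAbsLeOne F N ϑ.ν ϑ.τ9.M ϑ.ζ) (D : FiniteEpsData F (SU N)) (hD : D.AvgMeasurable) (g₀ : ℕ → ℝ) (os : List (ULoop F))
    {p : B12.RunParams} {g : ℕ → ℝ} (hg : g 0 = g₀ p.K) (t : ℝ) (k : ℕ) (s : SeqOfRecord F ϑ.ν ϑ.τ9.M g p.K k) :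
    Integrable (fun V => chiSeqOfRecord F N ϑ.ν ϑ.τ9.M g p.K k s V * dressedSlotsOfDatum₉ F N ϑ D g₀ os t p g k s V) (fieldMeasure (F.P p.K) k (SU N)) := by
  have hw0 : ∀ k s' U V', 0 ≤ wOfRecord₉ F N ϑ p g k s' U V' := wOfRecord₉_nonneg ϑ hζ0 p g
  have hw1 : ∀ k s' U V', wOfRecord₉ F N ϑ p g k s' U V' ≤ 1 := wOfRecord₉_le_one ϑ hζ1 p g
  have hwm : ∀ k s', Measurable (fun z : GaugeField (F.P p.K) (k + 1) (SU N) × GaugeField (F.P p.K) k (SU N) => wOfRecord₉ F N ϑ p g k s' z.2 z.1) :=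
    fun k s' => measurable_wOfRecord_of_localBg hU ϑ.τ9.M ϑ.A₁ hζm p g k s'
  have hχm : ∀ k s, Measurable (chiSeqOfRecord F N ϑ.ν ϑ.τ9.M g p.K k s) := fun k s => measurable_chiSeqOfRecord_of_localBg hU ϑ.τ9.M g p.K k s
  have heq := dressedSlotsOfDatum₉_ppSelLive_eq_ppSelId F N ϑ D g₀ os p g E hsel hg hD hw0 hwm hχm t k s
  have h' := integrable_chi_mul_dressedSlotsOfDatum₉_of_ppSelId { ϑ with ppSel := ppSelIdOfRecord F ϑ.ν ϑ.τ9.M } rfl hw0 hw1 hwm hχm D hD g₀ os t k s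
  exact h'.congr (ae_of_all _ fun V => by simp only [heq V])

/-- run A of record on the live line: F3's (e1) integrability of every top piece is a theorem (rows `hP.zetaAbs`, B1 `isPrintedAveraged_datumOfRecord₁₃CoPH` BY NAME;
displayed: the live-selector pin, (H-U), (H-ζ), `0 ≤ ζ`). [bookkeeping] -/
theorem integrable_topPieceA_of_liveSel (K₀ : ℕ) (θ : Stage13HParams F N) (hP : θ.Provisos₁₃CoPH F N) (E : B12.RunParams → ℝ)
    (hsel : θ.ppSel = ppSelLiveOfRecord F N θ.ν θ.τ9 E (wOfRecord₉ F N θ.toStage9Params))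
    (hU : LocalBgMeasurable F N θ.ν) (hζm : ZetaMeasurable F N θ.ζ) (hζ0 : ∀ p g k s Pl Ql RS U V', 0 ≤ θ.ζ p g k s Pl Ql RS U V')
    (g₀ : ℕ → ℝ) (os : List (ULoop F)) (K : ℕ) (t : ℝ) (s : SeqOfRecord F θ.ν θ.τ9.M (histA₁₃ θ K₀ g₀ K) (K₀ + K) (K₀ + K)) :
    Integrable (fun V => chiSeqOfRecord F N θ.ν θ.τ9.M (histA₁₃ θ K₀ g₀ K) (K₀ + K) (K₀ + K) s V *
      dressedSlotsOfDatum₉ F N θ.toStage9Params (datumOfRecord₁₃CoPH F N θ hP) g₀ os t (runA₁₃ F K₀ g₀ K) (histA₁₃ θ K₀ g₀ K) (K₀ + K) s V)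
      (fieldMeasure (F.P (K₀ + K)) (K₀ + K) (SU N)) :=
  integrable_chi_mul_dressedSlots_of_ppSelLive θ.toStage9Params E hsel hU hζm hζ0 hP.zetaAbs _ (isPrintedAveraged_datumOfRecord₁₃CoPH F N θ hP).avgMeasurable
    g₀ os (p := runA₁₃ F K₀ g₀ K) (histA₁₃_zero θ K₀ g₀ K) t (K₀ + K) s

/-- run B of record on the live line: F3's (e1) integrability of every top piece is a theorem. [bookkeeping] -/
theorem integrable_topPieceB_of_liveSel (K₀ : ℕ) (θ : Stage13HParams F N) (hP : θ.Provisos₁₃CoPH F N) (E : B12.RunParams → ℝ)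
    (hsel : θ.ppSel = ppSelLiveOfRecord F N θ.ν θ.τ9 E (wOfRecord₉ F N θ.toStage9Params))
    (hU : LocalBgMeasurable F N θ.ν) (hζm : ZetaMeasurable F N θ.ζ) (hζ0 : ∀ p g k s Pl Ql RS U V', 0 ≤ θ.ζ p g k s Pl Ql RS U V')
    (g₀ : ℕ → ℝ) (os : List (ULoop F)) (K : ℕ) (t : ℝ) (s' : SeqOfRecord F θ.ν θ.τ9.M (histB₁₃ θ K₀ g₀ K) (K₀ + K + 1) (K₀ + K + 1)) :
    Integrable (fun V => chiSeqOfRecord F N θ.ν θ.τ9.M (histB₁₃ θ K₀ g₀ K) (K₀ + K + 1) (K₀ + K + 1) s' V *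
      dressedSlotsOfDatum₉ F N θ.toStage9Params (datumOfRecord₁₃CoPH F N θ hP) g₀ os t (runB₁₃ F K₀ g₀ K) (histB₁₃ θ K₀ g₀ K) (K₀ + K + 1) s' V)
      (fieldMeasure (F.P (K₀ + K + 1)) (K₀ + K + 1) (SU N)) :=
  integrable_chi_mul_dressedSlots_of_ppSelLive θ.toStage9Params E hsel hU hζm hζ0 hP.zetaAbs _ (isPrintedAveraged_datumOfRecord₁₃CoPH F N θ hP).avgMeasurable
    g₀ os (p := runB₁₃ F K₀ g₀ K) (histB₁₃_zero θ K₀ g₀ K) t (K₀ + K + 1) s'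

/-- ★★★ **N21 AT THE SPINE READING OF RECORD WITH ITS SHELL SPLIT, ON THE LIVE LINE — displayed rows = n20-d's extraction rows + the estimate.**  At a tuple on the
live-selector line (`hsel`), under (H-U), (H-ζ), `0 ≤ ζ` (the rows of `keyedExtraction_crOfRecord₁₃At`), the width letters' signs, `0 ≤ D`, `Summable (D_K ρ_K)` per run and
the per-(run, K, t, top cube) (M1) on the record's truncated dressed laws: `ShellWeightBound` AT `crOfRecord₁₃At K₀ jcut (shellSplitOfRecord₁₃At N K₀ ρA ρB)`.
F3's (e1) integrability is supplied by §6; the (R)-fields, the cover and the count by §2–§5. [bookkeeping] -/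
theorem shellWeightBound_crOfRecord₁₃At_shellSplit_of_liveSel (K₀ : ℕ) (jcut : ℕ → ℕ) (ρA ρB : WidthLetter₁₃CoPH N) (θ : Stage13HParams F N)
    (hP : θ.Provisos₁₃CoPH F N) (g₀ : ℕ → ℝ) (os : List (ULoop F)) (E : B12.RunParams → ℝ)
    (hsel : θ.ppSel = ppSelLiveOfRecord F N θ.ν θ.τ9 E (wOfRecord₉ F N θ.toStage9Params))
    (hU : LocalBgMeasurable F N θ.ν) (hζm : ZetaMeasurable F N θ.ζ) (hζ0 : ∀ p g k s Pl Ql RS U V', 0 ≤ θ.ζ p g k s Pl Ql RS U V')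
    {DA DB : ℕ → ℝ} (hρA : ∀ K, 0 ≤ ρA F θ hP g₀ os K) (hDA : ∀ K, 0 ≤ DA K) (hρB : ∀ K, 0 ≤ ρB F θ hP g₀ os K) (hDB : ∀ K, 0 ≤ DB K)
    (hsA : Summable (fun K => DA K * ρA F θ hP g₀ os K)) (hsB : Summable (fun K => DB K * ρB F θ hP g₀ os K))
    (hM1A : ∀ (K : ℕ) (t : ℝ), |t| ≤ 1 →
      ∀ a : ↥(cubeIndices (F.P (K₀ + K)) (cubeSide (F.P (K₀ + K)).L θ.ν.M₂ (RkOfRecord (F.P (K₀ + K)).L θ.ν.r (histA₁₃ θ K₀ g₀ K (K₀ + K))) (K₀ + K))),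
        ∑ s, shellPieceOfDatum₉ F N θ.toStage9Params (datumOfRecord₁₃CoPH F N θ hP) g₀ os (runA₁₃ F K₀ g₀ K) (histA₁₃ θ K₀ g₀ K) (K₀ + K)
            (ρA F θ hP g₀ os K) t a s ≤
          (DA K * ρA F θ hP g₀ os K) *
            ∑ s, cubeWeightOfDatum₉ F N θ.toStage9Params (datumOfRecord₁₃CoPH F N θ hP) g₀ os (runA₁₃ F K₀ g₀ K) (histA₁₃ θ K₀ g₀ K) (K₀ + K) t a s)
    (hM1B : ∀ (K : ℕ) (t : ℝ), |t| ≤ 1 →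
      ∀ a : ↥(cubeIndices (F.P (K₀ + K + 1)) (cubeSide (F.P (K₀ + K + 1)).L θ.ν.M₂
          (RkOfRecord (F.P (K₀ + K + 1)).L θ.ν.r (histB₁₃ θ K₀ g₀ K (K₀ + K + 1))) (K₀ + K + 1))),
        ∑ s', shellPieceOfDatum₉ F N θ.toStage9Params (datumOfRecord₁₃CoPH F N θ hP) g₀ os (runB₁₃ F K₀ g₀ K) (histB₁₃ θ K₀ g₀ K) (K₀ + K + 1)
            (ρB F θ hP g₀ os K) t a s' ≤
          (DB K * ρB F θ hP g₀ os K) *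
            ∑ s', cubeWeightOfDatum₉ F N θ.toStage9Params (datumOfRecord₁₃CoPH F N θ hP) g₀ os (runB₁₃ F K₀ g₀ K) (histB₁₃ θ K₀ g₀ K) (K₀ + K + 1) t a s') :
    ShellWeightBound (crOfRecord₁₃At K₀ jcut (shellSplitOfRecord₁₃At N K₀ ρA ρB) F θ hP g₀ os).l₀
      (crOfRecord₁₃At K₀ jcut (shellSplitOfRecord₁₃At N K₀ ρA ρB) F θ hP g₀ os).T (crOfRecord₁₃At K₀ jcut (shellSplitOfRecord₁₃At N K₀ ρA ρB) F θ hP g₀ os).A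
      (crOfRecord₁₃At K₀ jcut (shellSplitOfRecord₁₃At N K₀ ρA ρB) F θ hP g₀ os).B (crOfRecord₁₃At K₀ jcut (shellSplitOfRecord₁₃At N K₀ ρA ρB) F θ hP g₀ os).shA
      (crOfRecord₁₃At K₀ jcut (shellSplitOfRecord₁₃At N K₀ ρA ρB) F θ hP g₀ os).shB (crOfRecord₁₃At K₀ jcut (shellSplitOfRecord₁₃At N K₀ ρA ρB) F θ hP g₀ os).Wsh :=
  shellWeightBound_crOfRecord₁₃At_shellSplit K₀ jcut ρA ρB θ hP g₀ os hU hζ0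
    (fun K t s => integrable_topPieceA_of_liveSel K₀ θ hP E hsel hU hζm hζ0 g₀ os K t s)
    (fun K t s' => integrable_topPieceB_of_liveSel K₀ θ hP E hsel hU hζm hζ0 g₀ os K t s') hρA hDA hρB hDB hsA hsB hM1A hM1B

end LiveLine

end Summit.QuantumFields.YangMills.Theorems.N21ShellSplitOfRecord13CoPH

end
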